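import Summits.Parity.GeneralizedHardyLittlewood.Theorems.GreenTaoLevelTwoGITwoCyclicInverseCauchySchwarz
import Summits.Parity.GeneralizedHardyLittlewood.Theorems.GreenTaoLevelTwoGITwoCyclicInverseBohrAveraging
import Summits.Parity.GeneralizedHardyLittlewood.Theorems.GreenTaoLevelTwoGITwoCyclicInverseBohrRegularPrelims
import Mathlib.Analysis.SpecialFunctions.Complex.CircleAddChar

/-!
# Route `GreenTaoLevelTwo`, crux `GITwo` (stmt-Parity-21275), line `birth`, stub `stub_cyclicInverse`:
# the symmetry argument, substitution step (GT08a arXiv Lemma 46, displays (eq9.74) ⇒ (eq9.75'))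

Forty-fifth helper file toward the XL stub `stub_cyclicInverse` (B. Green, T. Tao, *An inverse
theorem for the Gowers `U³(G)` norm*, arXiv:math/0503014, Thm. 68 = PEMS 51 (2008) Thm. 12.8).
Block C12: the second quarter of the proof of arXiv Lemma 46.  From
`K #B₁ #B₂² ≤ Σ_{h∈B₁} |Σ_{x∈B₂} c₂(x+h) c₃(x) e(−μ(h)x)|²` (output shape of
`exists_translate_sq_sum_ge`, `…SymmetryFront`), with `B₁ = B(S,ρ₁)` regular (`ρ₁ ≤ 1/8`),
`B₂ = B(S,ρ₂)` small (`800 d ρ₂ ≤ K ρ₁`) and `μ` additive on `B(S,¼)`: expand the square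
(`ofReal_sum_norm_sum_sq`), substitute `z = x + y + h` and move the `z`-range back to `B₁` by
arXiv Lemma 21 (i) (`norm_sum_shift_sub_sum_le_of_regular`), split the phase
`μ(z−x−y)·(x−y) = (μz·x − μx·x) − (μz·y − μy·y) + (μx·y − μy·x)` by local additivity, and pigeonhole
in `z`: some `1`-bounded `b, b'` (built from a good `z ∈ B₁`) have
`(K/2) #B₂² ≤ |Σ_{x,y∈B₂} b(x) b'(y) e(μ(x)y − μ(y)x)|` — display (eq9.75').

* `exists_bilinear_phase_average` — the statement above.

References: [GreenTao2008U3Inverse] arXiv:math/0503014, Lemma 46 (displays (eq9.74)–(eq9.75)).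
-/

noncomputable section

namespace Summit.Parity.GeneralizedHardyLittlewood.GreenTaoLevelTwoGITwoCyclicInverse

open Finset ZMod
open scoped ComplexConjugate

open Literature.NumberTheory.Sieve

variable {N : ℕ} [NeZero N]

/-- **(eq9.74) ⇒ (eq9.75') of GT08a arXiv Lemma 46.**  See the module docstring.
[cite: GreenTao2008U3Inverse, Lemma 46] -/
theorem exists_bilinear_phase_average (S : Finset (ZMod N)) (hS : S.Nonempty) {ρ₁ ρ₂ K : ℝ}
    (hρ₁ : 0 < ρ₁) (hρ₁8 : ρ₁ ≤ 1 / 8) (hρ₂ : 0 < ρ₂) (hK1 : K ≤ 1)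
    (hsmall : 800 * (#S : ℝ) * ρ₂ ≤ K * ρ₁)
    (hreg : ∀ κ : ℝ, |κ| ≤ 1 / (100 * (#S : ℝ)) →
      (1 - 100 * (#S : ℝ) * |κ|) * #{x : ZMod N | ∀ ξ ∈ S, ‖ZMod.toAddCircle (x * ξ)‖ < ρ₁} ≤
          #{x : ZMod N | ∀ ξ ∈ S, ‖ZMod.toAddCircle (x * ξ)‖ < (1 + κ) * ρ₁} ∧
        (#{x : ZMod N | ∀ ξ ∈ S, ‖ZMod.toAddCircle (x * ξ)‖ < (1 + κ) * ρ₁} : ℝ) ≤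
          (1 + 100 * (#S : ℝ) * |κ|) * #{x : ZMod N | ∀ ξ ∈ S, ‖ZMod.toAddCircle (x * ξ)‖ < ρ₁})
    {μ : ZMod N → ZMod N}
    (hadd : ∀ h₁ h₂ : ZMod N, (∀ ξ' ∈ S, ‖ZMod.toAddCircle (h₁ * ξ')‖ ≤ 1 / 4) →
      (∀ ξ' ∈ S, ‖ZMod.toAddCircle (h₂ * ξ')‖ ≤ 1 / 4) →
      (∀ ξ' ∈ S, ‖ZMod.toAddCircle ((h₁ + h₂) * ξ')‖ ≤ 1 / 4) → μ (h₁ + h₂) = μ h₁ + μ h₂)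
    (c₂ c₃ : ZMod N → ℂ) (hc₂ : ∀ x, ‖c₂ x‖ ≤ 1) (hc₃ : ∀ x, ‖c₃ x‖ ≤ 1)
    (hbig : K * #{x : ZMod N | ∀ ξ ∈ S, ‖ZMod.toAddCircle (x * ξ)‖ < ρ₁} *
        (#{x : ZMod N | ∀ ξ ∈ S, ‖ZMod.toAddCircle (x * ξ)‖ < ρ₂} : ℝ) ^ 2 ≤
      ∑ h ∈ ({x : ZMod N | ∀ ξ ∈ S, ‖ZMod.toAddCircle (x * ξ)‖ < ρ₁} : Finset (ZMod N)),
        ‖∑ x ∈ ({x : ZMod N | ∀ ξ ∈ S, ‖ZMod.toAddCircle (x * ξ)‖ < ρ₂} : Finset (ZMod N)),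
          c₂ (x + h) * c₃ x * stdAddChar (-(μ h * x))‖ ^ 2) :
    ∃ (b b' : ZMod N → ℂ), (∀ x, ‖b x‖ ≤ 1) ∧ (∀ y, ‖b' y‖ ≤ 1) ∧
      K / 2 * (#{x : ZMod N | ∀ ξ ∈ S, ‖ZMod.toAddCircle (x * ξ)‖ < ρ₂} : ℝ) ^ 2 ≤
        ‖∑ x ∈ ({x : ZMod N | ∀ ξ ∈ S, ‖ZMod.toAddCircle (x * ξ)‖ < ρ₂} : Finset (ZMod N)),
          ∑ y ∈ ({x : ZMod N | ∀ ξ ∈ S, ‖ZMod.toAddCircle (x * ξ)‖ < ρ₂} : Finset (ZMod N)),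
            b x * b' y * stdAddChar (μ x * y - μ y * x)‖ := by
  classical
  set B₁ : Finset (ZMod N) := {x : ZMod N | ∀ ξ ∈ S, ‖ZMod.toAddCircle (x * ξ)‖ < ρ₁} with hB₁def
  set B₂ : Finset (ZMod N) := {x : ZMod N | ∀ ξ ∈ S, ‖ZMod.toAddCircle (x * ξ)‖ < ρ₂} with hB₂def
  have hB₁ : ∀ x, x ∈ B₁ ↔ ∀ ξ ∈ S, ‖ZMod.toAddCircle (x * ξ)‖ < ρ₁ := fun x => by
    rw [hB₁def, mem_filter]; simp
  have hB₂ : ∀ x, x ∈ B₂ → ∀ ξ ∈ S, ‖ZMod.toAddCircle (x * ξ)‖ < ρ₂ := fun x hx => by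
    rw [hB₂def, mem_filter] at hx; exact hx.2
  have hd1 : (1 : ℝ) ≤ #S := by exact_mod_cast Nat.one_le_iff_ne_zero.mpr (card_pos.mpr hS).ne'
  have hB₁1 : (1 : ℝ) ≤ #B₁ := by exact_mod_cast one_le_card_bohr S hρ₁
  have hB₁ne : B₁.Nonempty := by
    rw [← card_pos]; have : (0 : ℝ) < #B₁ := by linarith
    exact_mod_cast this
  have hρ₂small : ρ₂ ≤ ρ₁ / 800 := by
    have : 800 * ρ₂ ≤ 800 * (#S : ℝ) * ρ₂ := by nlinarith
    nlinarith
  -- the scale `ε = 2ρ₂/ρ₁` and regularity of `B₁` at `±ε`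
  set ε : ℝ := 2 * ρ₂ / ρ₁ with hε
  have hε0 : 0 < ε := by positivity
  have hερ : ε * ρ₁ = 2 * ρ₂ := by rw [hε]; field_simp
  have h200 : 200 * (#S : ℝ) * ε ≤ K / 2 := by
    rw [hε]
    rw [show 200 * (#S : ℝ) * (2 * ρ₂ / ρ₁) = 400 * #S * ρ₂ / ρ₁ by ring, div_le_iff₀ hρ₁]
    linarith
  have hε100 : ε ≤ 1 / (100 * (#S : ℝ)) := by
    rw [le_div_iff₀ (by positivity)]
    nlinarith
  set Bp : Finset (ZMod N) := {x : ZMod N | ∀ ξ ∈ S, ‖ZMod.toAddCircle (x * ξ)‖ < (1 + ε) * ρ₁}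
    with hBpdef
  set Bm : Finset (ZMod N) := {x : ZMod N | ∀ ξ ∈ S, ‖ZMod.toAddCircle (x * ξ)‖ < (1 - ε) * ρ₁}
    with hBmdef
  have hBp : ∀ x, x ∈ Bp ↔ ∀ ξ ∈ S, ‖ZMod.toAddCircle (x * ξ)‖ < (1 + ε) * ρ₁ := fun x => by
    rw [hBpdef, mem_filter]; simp
  have hBm : ∀ x, x ∈ Bm ↔ ∀ ξ ∈ S, ‖ZMod.toAddCircle (x * ξ)‖ < (1 - ε) * ρ₁ := fun x => by
    rw [hBmdef, mem_filter]; simp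
  have hregp : (#Bp : ℝ) ≤ (1 + 100 * (#S : ℝ) * ε) * #B₁ := by
    have h := (hreg ε (by rw [abs_of_pos hε0]; exact hε100)).2
    rw [abs_of_pos hε0] at h; exact h
  have hregm : (1 - 100 * (#S : ℝ) * ε) * #B₁ ≤ (#Bm : ℝ) := by
    have h := (hreg (-ε) (by rw [abs_neg, abs_of_pos hε0]; exact hε100)).1
    rw [abs_neg, abs_of_pos hε0, ← sub_eq_add_neg] at h; exact h
  -- the functions
  set F : ZMod N → ZMod N → ℂ := fun h x => c₂ (x + h) * c₃ x * stdAddChar (-(μ h * x)) with hF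
  set G : ZMod N → ZMod N → ZMod N → ℂ := fun x y z =>
    c₂ (z - x) * c₃ y * conj (c₂ (z - y)) * conj (c₃ x) * stdAddChar (μ (z - x - y) * (x - y))
    with hG
  have hG1 : ∀ x y z, ‖G x y z‖ ≤ 1 := fun x y z => by
    rw [hG]; simp only
    rw [norm_mul, norm_mul, norm_mul, norm_mul, norm_stdAddChar, Complex.norm_conj,
      Complex.norm_conj, mul_one]
    calc ‖c₂ (z - x)‖ * ‖c₃ y‖ * ‖c₂ (z - y)‖ * ‖c₃ x‖ ≤ 1 * 1 * 1 * 1 := by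
          refine mul_le_mul (mul_le_mul (mul_le_mul (hc₂ _) (hc₃ _) (norm_nonneg _) zero_le_one)
            (hc₂ _) (norm_nonneg _) (by positivity)) (hc₃ _) (norm_nonneg _) (by positivity)
      _ = 1 := by ring
  -- `F h y conj(F h x) = G x y (h + (x + y))`
  have hFG : ∀ x y h, F h y * conj (F h x) = G x y (h + (x + y)) := by
    intro x y h
    rw [hF, hG]; simp only
    rw [map_mul, map_mul, conj_stdAddChar, neg_neg]
    have e1 : h + (x + y) - x = y + h := by ring
    have e2 : h + (x + y) - y = x + h := by ring
    have e3 : h + (x + y) - x - y = h := by ring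
    rw [e3, e1, e2]
    have e4 : (stdAddChar (-(μ h * y)) : ℂ) * stdAddChar (μ h * x) = stdAddChar (μ h * (x - y)) := by
      rw [← AddChar.map_add_eq_mul]; congr 1; ring
    calc c₂ (y + h) * c₃ y * (stdAddChar (-(μ h * y)) : ℂ) *
          (conj (c₂ (x + h)) * conj (c₃ x) * stdAddChar (μ h * x))
        = c₂ (y + h) * c₃ y * conj (c₂ (x + h)) * conj (c₃ x) *
            ((stdAddChar (-(μ h * y)) : ℂ) * stdAddChar (μ h * x)) := by ring
      _ = _ := by rw [e4]
  -- Step 4: expand the square and substitute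
  have hexp := ofReal_sum_norm_sum_sq B₁ B₂ F
  have hsum1 : ∑ h ∈ B₁, ∑ y ∈ B₂, ∑ x ∈ B₂, F h y * conj (F h x) =
      ∑ y ∈ B₂, ∑ x ∈ B₂, ∑ h ∈ B₁, G x y (h + (x + y)) := by
    rw [Finset.sum_comm]
    refine sum_congr rfl fun y _ => ?_
    rw [Finset.sum_comm]
    refine sum_congr rfl fun x _ => sum_congr rfl fun h _ => hFG x y h
  -- Step 5: move the `z`-range back to `B₁`
  have hshift : ∀ x ∈ B₂, ∀ y ∈ B₂,
      ‖∑ h ∈ B₁, G x y (h + (x + y)) - ∑ h ∈ B₁, G x y h‖ ≤ 200 * (#S : ℝ) * ε * #B₁ := by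
    intro x hx y hy
    have hxy : ∀ ξ ∈ S, ‖ZMod.toAddCircle ((x + y) * ξ)‖ ≤ ε * ρ₁ := by
      intro ξ hξ
      rw [hερ, add_mul, map_add]
      exact (norm_add_le _ _).trans (by linarith [hB₂ x hx ξ hξ, hB₂ y hy ξ hξ])
    exact norm_sum_shift_sub_sum_le_of_regular hB₁ hBp hBm hxy hS hregp hregm (hG1 x y)
  have hdiff : ‖(∑ y ∈ B₂, ∑ x ∈ B₂, ∑ h ∈ B₁, G x y (h + (x + y))) -
      ∑ y ∈ B₂, ∑ x ∈ B₂, ∑ z ∈ B₁, G x y z‖ ≤ (#B₂ : ℝ) ^ 2 * (200 * #S * ε * #B₁) := by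
    rw [← sum_sub_distrib]
    refine (norm_sum_le _ _).trans ?_
    have : ∀ y ∈ B₂, ‖∑ x ∈ B₂, ∑ h ∈ B₁, G x y (h + (x + y)) - ∑ x ∈ B₂, ∑ z ∈ B₁, G x y z‖ ≤
        #B₂ * (200 * (#S : ℝ) * ε * #B₁) := by
      intro y hy
      rw [← sum_sub_distrib]
      refine (norm_sum_le _ _).trans ?_
      calc ∑ x ∈ B₂, ‖∑ h ∈ B₁, G x y (h + (x + y)) - ∑ z ∈ B₁, G x y z‖
          ≤ ∑ x ∈ B₂, 200 * (#S : ℝ) * ε * #B₁ := sum_le_sum fun x hx => hshift x hx y hy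
        _ = #B₂ * (200 * (#S : ℝ) * ε * #B₁) := by rw [sum_const, nsmul_eq_mul]
    calc ∑ y ∈ B₂, ‖∑ x ∈ B₂, ∑ h ∈ B₁, G x y (h + (x + y)) - ∑ x ∈ B₂, ∑ z ∈ B₁, G x y z‖
        ≤ ∑ y ∈ B₂, #B₂ * (200 * (#S : ℝ) * ε * #B₁) := sum_le_sum this
      _ = (#B₂ : ℝ) ^ 2 * (200 * #S * ε * #B₁) := by rw [sum_const, nsmul_eq_mul]; ring
  -- the main term has norm `≥ (K/2) #B₁ #B₂²`
  have hmain : K / 2 * #B₁ * (#B₂ : ℝ) ^ 2 ≤ ‖∑ y ∈ B₂, ∑ x ∈ B₂, ∑ z ∈ B₁, G x y z‖ := by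
    have h1 : K * #B₁ * (#B₂ : ℝ) ^ 2 ≤ ‖∑ y ∈ B₂, ∑ x ∈ B₂, ∑ h ∈ B₁, G x y (h + (x + y))‖ := by
      rw [← hsum1, ← hexp, Complex.norm_real, Real.norm_eq_abs, abs_of_nonneg (by positivity)]
      exact hbig
    have h2 := norm_sub_norm_le (∑ y ∈ B₂, ∑ x ∈ B₂, ∑ h ∈ B₁, G x y (h + (x + y)))
      (∑ y ∈ B₂, ∑ x ∈ B₂, ∑ z ∈ B₁, G x y z)
    have h3 : (#B₂ : ℝ) ^ 2 * (200 * #S * ε * #B₁) ≤ K / 2 * #B₁ * (#B₂ : ℝ) ^ 2 := by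
      have := mul_le_mul_of_nonneg_left h200 (by positivity : (0 : ℝ) ≤ (#B₂ : ℝ) ^ 2 * #B₁)
      calc (#B₂ : ℝ) ^ 2 * (200 * #S * ε * #B₁) = (#B₂ : ℝ) ^ 2 * #B₁ * (200 * #S * ε) := by ring
        _ ≤ (#B₂ : ℝ) ^ 2 * #B₁ * (K / 2) := this
        _ = K / 2 * #B₁ * (#B₂ : ℝ) ^ 2 := by ring
    linarith [hdiff]
  -- Step 6: pigeonhole in `z`
  rw [Finset.sum_comm] at hmain
  simp_rw [Finset.sum_comm (s := B₂) (t := B₁)] at hmain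
  -- now `hmain : K/2 #B₁ #B₂² ≤ ‖Σ_{z∈B₁} Σ_{x} Σ_{y} G x y z‖`
  have havg : ∑ z ∈ B₁, K / 2 * (#B₂ : ℝ) ^ 2 ≤ ∑ z ∈ B₁, ‖∑ x ∈ B₂, ∑ y ∈ B₂, G x y z‖ := by
    rw [sum_const, nsmul_eq_mul]
    calc (#B₁ : ℝ) * (K / 2 * (#B₂ : ℝ) ^ 2) = K / 2 * #B₁ * (#B₂ : ℝ) ^ 2 := by ring
      _ ≤ _ := hmain
      _ ≤ _ := norm_sum_le _ _
  obtain ⟨z, hz, hzbig⟩ := exists_le_of_sum_le hB₁ne havg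
  -- Step 7: split the phase by local additivity (for `x, y ∈ B₂`, `z ∈ B₁`)
  have hμ : ∀ x ∈ B₂, ∀ y ∈ B₂, μ (z - x - y) = μ z - μ x - μ y := by
    intro x hx y hy
    have hzb := (hB₁ z).mp hz
    have hq : ∀ p : ZMod N, ∀ s : ℝ, (∀ ξ ∈ S, ‖ZMod.toAddCircle (p * ξ)‖ ≤ s) → s ≤ 1 / 4 →
        ∀ ξ ∈ S, ‖ZMod.toAddCircle (p * ξ)‖ ≤ 1 / 4 := fun p s hp hs ξ hξ => (hp ξ hξ).trans hs
    have h1b : ∀ ξ ∈ S, ‖ZMod.toAddCircle ((z - x - y) * ξ)‖ ≤ ρ₁ + 2 * ρ₂ := by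
      intro ξ hξ
      rw [sub_mul, sub_mul, map_sub, map_sub]
      refine (norm_sub_le _ _).trans ?_
      have := (norm_sub_le (ZMod.toAddCircle (z * ξ)) (ZMod.toAddCircle (x * ξ)))
      linarith [hzb ξ hξ, hB₂ x hx ξ hξ, hB₂ y hy ξ hξ]
    have h2b : ∀ ξ ∈ S, ‖ZMod.toAddCircle ((z - x) * ξ)‖ ≤ ρ₁ + ρ₂ := by
      intro ξ hξ
      rw [sub_mul, map_sub]
      exact (norm_sub_le _ _).trans (by linarith [hzb ξ hξ, hB₂ x hx ξ hξ])
    have hA : μ (z - x - y + y) = μ (z - x - y) + μ y :=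
      hadd _ _ (hq _ _ h1b (by linarith)) (hq _ _ (fun ξ hξ => (hB₂ y hy ξ hξ).le) (by linarith))
        (by rw [sub_add_cancel]; exact hq _ _ h2b (by linarith))
    have hB : μ (z - x + x) = μ (z - x) + μ x :=
      hadd _ _ (hq _ _ h2b (by linarith)) (hq _ _ (fun ξ hξ => (hB₂ x hx ξ hξ).le) (by linarith))
        (by rw [sub_add_cancel]; exact hq _ _ (fun ξ hξ => (hzb ξ hξ).le) (hρ₁8.trans (by norm_num)))
    rw [sub_add_cancel] at hA hB
    linear_combination -hA - hB
  -- the functions `b, b'`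
  set b : ZMod N → ℂ := fun x => c₂ (z - x) * conj (c₃ x) * stdAddChar (μ z * x - μ x * x) with hb
  set b' : ZMod N → ℂ := fun y => c₃ y * conj (c₂ (z - y)) * stdAddChar (-(μ z * y - μ y * y))
    with hb'
  have hb1 : ∀ x, ‖b x‖ ≤ 1 := fun x => by
    rw [hb]; simp only
    rw [norm_mul, norm_mul, norm_stdAddChar, Complex.norm_conj, mul_one]
    calc ‖c₂ (z - x)‖ * ‖c₃ x‖ ≤ 1 * 1 :=
          mul_le_mul (hc₂ _) (hc₃ _) (norm_nonneg _) zero_le_one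
      _ = 1 := one_mul _
  have hb'1 : ∀ y, ‖b' y‖ ≤ 1 := fun y => by
    rw [hb']; simp only
    rw [norm_mul, norm_mul, norm_stdAddChar, Complex.norm_conj, mul_one]
    calc ‖c₃ y‖ * ‖c₂ (z - y)‖ ≤ 1 * 1 :=
          mul_le_mul (hc₃ _) (hc₂ _) (norm_nonneg _) zero_le_one
      _ = 1 := one_mul _
  have hGbb : ∀ x ∈ B₂, ∀ y ∈ B₂, G x y z = b x * b' y * stdAddChar (μ x * y - μ y * x) := by
    intro x hx y hy
    rw [hG, hb, hb']; simp only
    rw [hμ x hx y hy]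
    have e1 : (stdAddChar ((μ z - μ x - μ y) * (x - y)) : ℂ) =
        stdAddChar (μ z * x - μ x * x) * stdAddChar (-(μ z * y - μ y * y)) *
          stdAddChar (μ x * y - μ y * x) := by
      rw [← AddChar.map_add_eq_mul, ← AddChar.map_add_eq_mul]; congr 1; ring
    rw [e1]; ring
  refine ⟨b, b', hb1, hb'1, ?_⟩
  have hfinal : ∑ x ∈ B₂, ∑ y ∈ B₂, b x * b' y * stdAddChar (μ x * y - μ y * x) =
      ∑ x ∈ B₂, ∑ y ∈ B₂, G x y z :=
    sum_congr rfl fun x hx => sum_congr rfl fun y hy => (hGbb x hx y hy).symm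
  rw [hfinal]
  exact hzbig

end Summit.Parity.GeneralizedHardyLittlewood.GreenTaoLevelTwoGITwoCyclicInverse
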